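import Mathlib
import Literature.Analysis.Fourier.HilbertTransformLineL2
import Literature.Analysis.Fourier.TitchmarshFourierSpectrumMul
import HarnessLib

/-!
# The Hilbert transform on the line as the Fourier multiplier `−i·sgn`, tested against Schwartz functions,
# and the analytic signal `f + iHf` as an inverse Fourier integral over the positive frequencies

`Literature/Analysis/Fourier`. Conventions of the tree: `hilbertTransform f x = π⁻¹∫_{t>0}(f(x−t) − f(x+t))/t dt`
(`H cos = sin`; `HilbertTransformLine.lean`) and Mathlib's `𝓕 f k = ∫ f(x) e^{−2πikx} dx`. The truncations
`H_{1/(n+1),n+1} f` have Fourier transform `m_n · 𝓕f` with `|m_n| ≤ 7`, `m_n(k) → −i sgn k`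
(`HilbertTransformLineMultiplier.lean`) and converge to `Hf` in `L²` (`HilbertTransformLineL2.lean`). Here we record the
consequences that are used to manipulate `Hf` on the Fourier side WITHOUT an `L²` Fourier transform:

* `integral_hilbertTransform_mul_fourier_eq` — **the tested multiplier identity**: for real `f ∈ L¹ ∩ L²` with
  a.e.-integrable symmetric p.v. integrand and every `θ ∈ L¹` with `𝓕θ ∈ L²`,
  `∫ (Hf)(x)·𝓕θ(x) dx = ∫ (−i sgn k)·𝓕f(k)·θ(k) dk`   («`(Hf)^ = −i sgn(ξ) f̂`» in the sense of distributions);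
* `integral_fourierInv_mul_fourier_eq` — `∫ 𝓕⁻G · 𝓕θ = ∫ G · θ` for `G ∈ L¹` and `θ` continuous, integrable with
  `𝓕θ` integrable; `eq_zero_of_forall_integral_mul_fourier_schwartz` — a continuous function that annihilates every
  `𝓕θ`, `θ` Schwartz, is zero;
* `analyticSignal_eq_fourierInv` — **the analytic signal is an inverse Fourier integral over `k > 0`**: if moreover `f` and
  `Hf` are continuous and `𝓕f ∈ L¹`, then for every `x`
  `f(x) + i·(Hf)(x) = 𝓕⁻[(1 + sgn k)·𝓕f](x)`
  — the «analytic signal» `f + iHf` carries no negative frequencies.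
Sources: the multiplier `(Hf)^ = −i sgn · f̂` [cite: King2009HilbertTransforms2, eq. (15.59) (case n = 1)],
[cite: Grafakos2014, eq. (5.1.12)]; the analytic signal and its one-sided spectrum [cite: King2009HilbertTransforms2, §18.4].
Auxiliary: `measurable_real_sign`, `tendsto_integral_mul_of_eLpNorm_sub_tendsto_zero` (Hölder), all folklore.
MOTIVATION (cell ns-blowup, zone Z3, MODEL): the product rule `H(f·Hf) = ½((Hf)² − f²)` (`HilbertTransformLineCotlar.lean`)
and the Schochet-corner classification of the viscous CLM profile equation. WHAT THIS IS NOT: not Navier–Stokes; no statement about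
an `L²`-Fourier transform (everything is tested against `𝓕θ` or uses `L¹` Fourier integrals). No definitions.
-/

namespace Literature.Analysis.Fourier

open _root_.MeasureTheory Set Filter _root_.Complex SchwartzMap
open Literature.NumberTheory.ConnesConsani2021 Literature.Analysis.FunctionSpaces
open scoped Real Topology ENNReal FourierTransform

/-! ### Plumbing -/

/-- `Real.sign` is measurable (a step function). [folklore] -/
private theorem measurable_real_sign : Measurable Real.sign := by
  have : Real.sign = fun r : ℝ => if r < 0 then (-1 : ℝ) else if 0 < r then 1 else 0 := by
    funext r; rfl
  rw [this]
  exact Measurable.ite measurableSet_Iio measurable_const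
    (Measurable.ite measurableSet_Ioi measurable_const measurable_const)


/-- The exhausting windows are non-degenerate: `0 < 1/(n+1)`. [folklore] -/
private theorem win_pos (n : ℕ) : (0 : ℝ) < 1 / ((n : ℝ) + 1) := by positivity

/-- The exhausting windows are non-degenerate: `1/(n+1) ≤ n+1`. [folklore] -/
private theorem win_le (n : ℕ) : 1 / ((n : ℝ) + 1) ≤ (n : ℝ) + 1 := by
  rw [div_le_iff₀ (by positivity)]; nlinarith [sq_nonneg (n : ℝ)]

/-- If `F n → F₀` in `L²` (`‖F n − F₀‖₂ → 0`) and `G ∈ L²`, then `∫ F n · G → ∫ F₀ · G` (Hölder). [folklore] -/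
private theorem tendsto_integral_mul_of_eLpNorm_sub_tendsto_zero {F : ℕ → ℝ → ℂ} {F₀ G : ℝ → ℂ}
    (hF : ∀ n, MemLp (F n) 2) (hF₀ : MemLp F₀ 2) (hG : MemLp G 2)
    (h : Tendsto (fun n => eLpNorm (fun x => F n x - F₀ x) 2 volume) atTop (𝓝 0)) :
    Tendsto (fun n => ∫ x, F n x * G x) atTop (𝓝 (∫ x, F₀ x * G x)) := by
  rw [tendsto_iff_norm_sub_tendsto_zero]
  have h22 : (2 : ℝ).HolderConjugate 2 := by
    rw [Real.holderConjugate_iff]; norm_num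
  -- the `L²` norms as real numbers
  set a : ℕ → ℝ := fun n => (∫ x, ‖F n x - F₀ x‖ ^ (2 : ℝ)) ^ (1 / (2 : ℝ)) with ha
  set b : ℝ := (∫ x, ‖G x‖ ^ (2 : ℝ)) ^ (1 / (2 : ℝ)) with hb
  have hdiff : ∀ n, MemLp (fun x => F n x - F₀ x) 2 := fun n => (hF n).sub hF₀
  have ha_eq : ∀ n, ENNReal.ofReal (a n) = eLpNorm (fun x => F n x - F₀ x) 2 volume := by
    intro n
    rw [(hdiff n).eLpNorm_eq_integral_rpow_norm two_ne_zero ENNReal.ofNat_ne_top]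
    simp [ha]
  have ha0 : ∀ n, 0 ≤ a n := fun n => by positivity
  have ha_t : Tendsto a atTop (𝓝 0) := by
    have h' : Tendsto (fun n => (eLpNorm (fun x => F n x - F₀ x) 2 volume).toReal) atTop (𝓝 (0 : ℝ≥0∞).toReal) :=
      (ENNReal.tendsto_toReal ENNReal.zero_ne_top).comp h
    rw [ENNReal.toReal_zero] at h'
    refine h'.congr fun n => ?_
    rw [← ha_eq n, ENNReal.toReal_ofReal (ha0 n)]
  have hbound : ∀ n, ‖(∫ x, F n x * G x) - ∫ x, F₀ x * G x‖ ≤ a n * b := by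
    intro n
    have hi1 : Integrable (fun x => F n x * G x) := (hF n).integrable_mul hG
    have hi0 : Integrable (fun x => F₀ x * G x) := hF₀.integrable_mul hG
    rw [← integral_sub hi1 hi0]
    calc ‖∫ x, (F n x * G x - F₀ x * G x)‖ ≤ ∫ x, ‖F n x * G x - F₀ x * G x‖ :=
          norm_integral_le_integral_norm _
      _ = ∫ x, ‖F n x - F₀ x‖ * ‖G x‖ := by
          congr 1 with x; rw [← sub_mul, norm_mul]
      _ ≤ a n * b := by
          have := integral_mul_norm_le_Lp_mul_Lq (μ := volume) h22
            (by simpa using hdiff n) (by simpa using hG)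
          simpa [ha, hb] using this
  refine squeeze_zero (fun n => norm_nonneg _) hbound ?_
  simpa using ha_t.mul_const b

/-! ### The tested multiplier identity -/

/-- **`(Hf)^ = −i·sgn·f̂`, tested against `𝓕θ`.** For a real `f ∈ L¹(ℝ) ∩ L²(ℝ)` whose symmetric p.v. integrand is
integrable on `(0,∞)` at a.e. point, and any `θ ∈ L¹` with `𝓕θ ∈ L²`:
`∫ (Hf)(x) 𝓕θ(x) dx = ∫ (−i sgn k) 𝓕f(k) θ(k) dk`. Proof: for the truncations, `∫ H_n f · 𝓕θ = ∫ 𝓕(H_n f)·θ =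
∫ m_n 𝓕f θ` (multiplication formula + `fourier_hilbertTransformTrunc`); let `n → ∞` (`L²` convergence on the left,
dominated convergence with `|m_n| ≤ 7` on the right). [cite: King2009HilbertTransforms2, eq. (15.59) (case n = 1)]
[cite: Grafakos2014, eqs. (5.1.12)–(5.1.13)] -/
theorem integral_hilbertTransform_mul_fourier_eq {f : ℝ → ℝ} (hf : Integrable f) (hf2 : MemLp f 2)
    (hint : ∀ᵐ x : ℝ, IntegrableOn (fun t => (f (x - t) - f (x + t)) / t) (Ioi 0))
    {θ : ℝ → ℂ} (hθ : Integrable θ) (hθ2 : MemLp (𝓕 θ) 2) :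
    ∫ x, (hilbertTransform f x : ℂ) * 𝓕 θ x
      = ∫ k, ((((-Real.sign k) : ℝ) : ℂ) * I) * 𝓕 (fun x => (f x : ℂ)) k * θ k := by
  -- the truncations
  set u : ℕ → ℝ → ℂ := fun n x => (hilbertTransformTrunc (1 / ((n : ℝ) + 1)) ((n : ℝ) + 1) f x : ℂ) with hu
  have hu_int : ∀ n, Integrable (u n) := fun n =>
    (integrable_hilbertTransformTrunc hf (win_pos n) (R := (n : ℝ) + 1)).ofReal
  have hu_2 : ∀ n, MemLp (u n) 2 := fun n => by
    have h := memLp_two_hilbertTransformTrunc hf hf2 (win_pos n) (R := (n : ℝ) + 1)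
    exact MemLp.of_le h (Complex.continuous_ofReal.comp_aestronglyMeasurable h.1)
      (ae_of_all _ fun x => by simp [hu])
  -- step 1: the identity for the truncations
  have hstep : ∀ n : ℕ, ∫ x, u n x * 𝓕 θ x = ∫ k,
      (((-(2 / π * (sinIntegral (2 * π * k * ((n : ℝ) + 1)) - sinIntegral (2 * π * k * (1 / ((n : ℝ) + 1)))))) : ℝ)
        : ℂ) * I * 𝓕 (fun x => (f x : ℂ)) k * θ k := by
    intro n
    rw [← integral_fourier_mul_eq_flip (hu_int n) hθ]
    refine integral_congr_ae (ae_of_all _ fun k => ?_)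
    simp only [hu]
    rw [fourier_hilbertTransformTrunc hf (win_pos n) (win_le n) k]
  -- step 2: the right-hand sides converge (dominated convergence, `|m_n| ≤ 7`)
  have hFc : Continuous (𝓕 (fun x => (f x : ℂ))) := continuous_fourierIntegral hf.ofReal
  have hFb : ∀ k, ‖𝓕 (fun x => (f x : ℂ)) k‖ ≤ ∫ x, ‖(f x : ℂ)‖ := fun k =>
    VectorFourier.norm_fourierIntegral_le_integral_norm 𝐞 volume (innerₗ ℝ) (fun x => (f x : ℂ)) k
  have hright : Tendsto (fun n : ℕ => ∫ k,
      (((-(2 / π * (sinIntegral (2 * π * k * ((n : ℝ) + 1)) - sinIntegral (2 * π * k * (1 / ((n : ℝ) + 1)))))) : ℝ)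
        : ℂ) * I * 𝓕 (fun x => (f x : ℂ)) k * θ k) atTop
      (𝓝 (∫ k, ((((-Real.sign k) : ℝ) : ℂ) * I) * 𝓕 (fun x => (f x : ℂ)) k * θ k)) := by
    refine tendsto_integral_of_dominated_convergence (fun k => 7 * (∫ x, ‖(f x : ℂ)‖) * ‖θ k‖) ?_ ?_ ?_ ?_
    · intro n
      have hmc : Continuous fun k : ℝ =>
          (((-(2 / π * (sinIntegral (2 * π * k * ((n : ℝ) + 1)) - sinIntegral (2 * π * k * (1 / ((n : ℝ) + 1))))))
            : ℝ) : ℂ) * I := by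
        refine (Complex.continuous_ofReal.comp ?_).mul continuous_const
        exact ((continuous_sinIntegral.comp (by fun_prop)).sub
          (continuous_sinIntegral.comp (by fun_prop))).const_mul _ |>.neg
      exact ((hmc.mul hFc).aestronglyMeasurable).mul hθ.1
    · exact (hθ.norm.const_mul _)
    · intro n
      refine ae_of_all _ fun k => ?_
      rw [norm_mul, norm_mul]
      have h1 := norm_hilbertTruncMultiplier_le (2 * π * k * (1 / ((n : ℝ) + 1))) (2 * π * k * ((n : ℝ) + 1))
      have h2 := hFb k
      have h3 : 0 ≤ ∫ x, ‖(f x : ℂ)‖ := integral_nonneg fun x => norm_nonneg _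
      have h4 : 0 ≤ ‖θ k‖ := norm_nonneg _
      exact mul_le_mul (mul_le_mul h1 h2 (norm_nonneg _) (by norm_num)) le_rfl h4 (by positivity)
    · refine ae_of_all _ fun k => ?_
      have h := ((Complex.continuous_ofReal.tendsto _).comp (tendsto_hilbertTruncMultiplier k))
      exact ((h.mul_const I).mul_const _).mul_const _
  -- step 3: the left-hand sides converge (`L²` convergence of the truncations)
  have hH2 : MemLp (fun x => (hilbertTransform f x : ℂ)) 2 := by
    have h := memLp_two_hilbertTransform hf hf2 hint
    exact MemLp.of_le h (Complex.continuous_ofReal.comp_aestronglyMeasurable h.1)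
      (ae_of_all _ fun x => by simp)
  have hleft : Tendsto (fun n => ∫ x, u n x * 𝓕 θ x) atTop (𝓝 (∫ x, (hilbertTransform f x : ℂ) * 𝓕 θ x)) := by
    refine tendsto_integral_mul_of_eLpNorm_sub_tendsto_zero hu_2 hH2 hθ2 ?_
    have h := tendsto_eLpNorm_hilbertTransformTrunc_sub hf hf2 hint
    refine h.congr fun n => ?_
    refine eLpNorm_congr_norm_ae (ae_of_all _ fun x => ?_)
    simp only [hu]
    rw [← Complex.ofReal_sub, Complex.norm_real]
  -- conclude
  rw [funext hstep] at hleft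
  exact tendsto_nhds_unique hleft hright

/-! ### Pairing an inverse Fourier integral with `𝓕θ`; annihilating all `𝓕θ` -/

/-- `∫ 𝓕⁻G(x)·𝓕θ(x) dx = ∫ G(k)·θ(k) dk` for `G ∈ L¹` and `θ` continuous, integrable, with `𝓕θ` integrable:
the multiplication formula `∫ f̂ g = ∫ f ĝ` combined with the Fourier inversion formula for `θ`.
[cite: HormanderALPDO1, Thm. 7.1.6 (with the inversion formula Thm. 7.1.5)] -/
theorem integral_fourierInv_mul_fourier_eq {G θ : ℝ → ℂ} (hG : Integrable G) (hθc : Continuous θ)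
    (hθ : Integrable θ) (hFθ : Integrable (𝓕 θ)) :
    ∫ x, 𝓕⁻ G x * 𝓕 θ x = ∫ k, G k * θ k := by
  rw [Real.fourierInv_eq_fourier_comp_neg]
  have hGn : Integrable (fun x : ℝ => G (-x)) := hG.comp_neg
  rw [integral_fourier_mul_eq_flip hGn hFθ]
  -- `∫ G(−k) 𝓕(𝓕θ)(k) dk = ∫ G(k) 𝓕(𝓕θ)(−k) dk = ∫ G(k) θ(k) dk`
  have hinv : ∀ k, 𝓕 (𝓕 θ) (-k) = θ k := by
    intro k
    rw [← Real.fourierInv_eq_fourier_neg]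
    exact congrFun (hθc.fourierInv_fourier_eq hθ hFθ) k
  calc ∫ k, G (-k) * 𝓕 (𝓕 θ) k = ∫ k, G (-k) * θ (-k) := by
        congr 1 with k; rw [← hinv (-k), neg_neg]
    _ = ∫ k, G k * θ k := integral_neg_eq_self (fun k => G k * θ k) volume

/-- A continuous `D : ℝ → ℂ` with `∫ D·𝓕θ = 0` for every Schwartz `θ` vanishes identically: `𝓕` maps `𝓢` onto `𝓢`
(so `∫ D ψ = 0` for every Schwartz `ψ`, in particular every `ψ ∈ C_c^∞`), and a locally integrable function annihilating
`C_c^∞` vanishes a.e. (du Bois-Reymond), hence everywhere by continuity.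
[cite: HormanderALPDO1, Thm. 7.1.5 (𝓕 : 𝓢 → 𝓢 is an isomorphism) with Thm. 1.2.5] -/
theorem eq_zero_of_forall_integral_mul_fourier_schwartz {D : ℝ → ℂ} (hD : Continuous D)
    (h : ∀ θ : 𝓢(ℝ, ℂ), ∫ x, D x * 𝓕 (θ : ℝ → ℂ) x = 0) : D = 0 := by
  -- every Schwartz `ψ` annihilates `D`
  have hψ : ∀ ψ : 𝓢(ℝ, ℂ), ∫ x, D x * ψ x = 0 := by
    intro ψ
    have h1 := h (𝓕⁻ ψ)
    have hcoe : 𝓕 ((𝓕⁻ ψ : 𝓢(ℝ, ℂ)) : ℝ → ℂ) = ((ψ : 𝓢(ℝ, ℂ)) : ℝ → ℂ) := by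
      rw [← SchwartzMap.fourier_coe, FourierTransform.fourier_fourierInv_eq]
    rwa [hcoe] at h1
  -- hence `D = 0` a.e.
  have hae : ∀ᵐ x : ℝ, D x = 0 := by
    refine ae_eq_zero_of_integral_contDiff_smul_eq_zero hD.locallyIntegrable fun g hg hgc => ?_
    have hgℂ : ContDiff ℝ (⊤ : ℕ∞) (fun x => (g x : ℂ)) := Complex.ofRealCLM.contDiff.comp hg
    have hgcℂ : HasCompactSupport (fun x => (g x : ℂ)) := hgc.comp_left Complex.ofReal_zero
    have h2 := hψ (hgcℂ.toSchwartzMap hgℂ)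
    have hcoe : ((hgcℂ.toSchwartzMap hgℂ : 𝓢(ℝ, ℂ)) : ℝ → ℂ) = fun x => (g x : ℂ) := rfl
    rw [hcoe] at h2
    rw [← h2]
    congr 1 with x
    rw [Complex.real_smul, mul_comm]
  -- and everywhere by continuity
  have : D =ᵐ[volume] (0 : ℝ → ℂ) := hae
  exact (Continuous.ae_eq_iff_eq volume hD continuous_const).mp this

/-! ### The analytic signal -/

/-- **The analytic signal as an inverse Fourier integral over the positive frequencies.** Let `f : ℝ → ℝ` be continuous,
in `L¹ ∩ L²`, with symmetric p.v. integrand integrable at a.e. point, with `Hf` continuous and `𝓕f ∈ L¹`. Then for every `x`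
`f(x) + i·Hf(x) = 𝓕⁻[(1 + sgn k)·𝓕f(k)](x)`.
Proof: both sides are continuous and have the same pairing with every `𝓕θ`, `θ` Schwartz
(`integral_hilbertTransform_mul_fourier_eq`, `integral_fourierInv_mul_fourier_eq`).
[cite: King2009HilbertTransforms2, §18.4 (the analytic signal) with eq. (15.59), n = 1] -/
theorem analyticSignal_eq_fourierInv {f : ℝ → ℝ} (hfc : Continuous f) (hf : Integrable f) (hf2 : MemLp f 2)
    (hint : ∀ᵐ x : ℝ, IntegrableOn (fun t => (f (x - t) - f (x + t)) / t) (Ioi 0))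
    (hHc : Continuous (hilbertTransform f)) (hFf : Integrable (𝓕 (fun x => (f x : ℂ)))) (x : ℝ) :
    (f x : ℂ) + I * hilbertTransform f x
      = 𝓕⁻ (fun k => (1 + ((Real.sign k : ℝ) : ℂ)) * 𝓕 (fun y => (f y : ℂ)) k) x := by
  set G : ℝ → ℂ := fun k => (1 + ((Real.sign k : ℝ) : ℂ)) * 𝓕 (fun y => (f y : ℂ)) k with hG
  have hGi : Integrable G := by
    refine (hFf.norm.const_mul 2).mono' ?_ (ae_of_all _ fun k => ?_)
    · have hms : Measurable fun k : ℝ => ((Real.sign k : ℝ) : ℂ) :=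
        Complex.measurable_ofReal.comp measurable_real_sign
      exact ((hms.const_add 1).aestronglyMeasurable.mul hFf.1)
    · simp only [hG, norm_mul]
      have hs : ‖(1 : ℂ) + ((Real.sign k : ℝ) : ℂ)‖ ≤ 2 := by
        rcases lt_trichotomy k 0 with hk | rfl | hk
        · rw [Real.sign_of_neg hk]; simp
        · rw [Real.sign_zero]; simp
        · rw [Real.sign_of_pos hk]; norm_num
      have h0 : 0 ≤ ‖𝓕 (fun y => (f y : ℂ)) k‖ := norm_nonneg _
      exact mul_le_mul_of_nonneg_right hs h0
  -- the difference `D = (f + iHf) − 𝓕⁻G` is continuous and annihilates every `𝓕θ`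
  set D : ℝ → ℂ := fun x => ((f x : ℂ) + I * hilbertTransform f x) - 𝓕⁻ G x with hD
  have hDc : Continuous D := by
    have h1 : Continuous fun x => ((f x : ℂ) + I * hilbertTransform f x) :=
      (Complex.continuous_ofReal.comp hfc).add (continuous_const.mul (Complex.continuous_ofReal.comp hHc))
    have h2 : Continuous (𝓕⁻ G) := by
      rw [Real.fourierInv_eq_fourier_comp_neg]
      exact continuous_fourierIntegral hGi.comp_neg
    exact h1.sub h2
  have hD0 : D = 0 := by
    refine eq_zero_of_forall_integral_mul_fourier_schwartz hDc fun θ => ?_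
    have hθi : Integrable (θ : ℝ → ℂ) := θ.integrable
    have hFθi : Integrable (𝓕 (θ : ℝ → ℂ)) := by
      rw [← SchwartzMap.fourier_coe]; exact (𝓕 θ).integrable
    have hFθ2 : MemLp (𝓕 (θ : ℝ → ℂ)) 2 := by
      rw [← SchwartzMap.fourier_coe]; exact (𝓕 θ).memLp 2
    -- integrability of the pairings
    have hf2ℂ : MemLp (fun x => (f x : ℂ)) 2 :=
      MemLp.of_le hf2 (Complex.continuous_ofReal.comp_aestronglyMeasurable hf2.1)
        (ae_of_all _ fun x => by simp)
    have hH2ℂ : MemLp (fun x => (hilbertTransform f x : ℂ)) 2 := by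
      have h := memLp_two_hilbertTransform hf hf2 hint
      exact MemLp.of_le h (Complex.continuous_ofReal.comp_aestronglyMeasurable h.1) (ae_of_all _ fun x => by simp)
    have hi_f : Integrable fun x => (f x : ℂ) * 𝓕 (θ : ℝ → ℂ) x := hf2ℂ.integrable_mul hFθ2
    have hi_H : Integrable fun x => (hilbertTransform f x : ℂ) * 𝓕 (θ : ℝ → ℂ) x := hH2ℂ.integrable_mul hFθ2
    have hGb : ∀ x, ‖𝓕⁻ G x‖ ≤ ∫ k, ‖G k‖ := by
      intro x
      rw [Real.fourierInv_eq_fourier_neg]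
      exact VectorFourier.norm_fourierIntegral_le_integral_norm 𝐞 volume (innerₗ ℝ) G (-x)
    have hGc : Continuous (𝓕⁻ G) := by
      rw [Real.fourierInv_eq_fourier_comp_neg]
      exact continuous_fourierIntegral hGi.comp_neg
    have hi_G : Integrable fun x => 𝓕⁻ G x * 𝓕 (θ : ℝ → ℂ) x :=
      hFθi.bdd_mul hGc.aestronglyMeasurable (ae_of_all _ hGb)
    -- the three pairings evaluated on the Fourier side
    have e_f : ∫ x, (f x : ℂ) * 𝓕 (θ : ℝ → ℂ) x = ∫ k, 𝓕 (fun y => (f y : ℂ)) k * θ k :=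
      (integral_fourier_mul_eq_flip hf.ofReal hθi).symm
    have e_H := integral_hilbertTransform_mul_fourier_eq hf hf2 hint hθi hFθ2
    have e_G : ∫ x, 𝓕⁻ G x * 𝓕 (θ : ℝ → ℂ) x = ∫ k, G k * θ k :=
      integral_fourierInv_mul_fourier_eq hGi θ.continuous hθi hFθi
    -- integrability on the Fourier side
    have hFc : Continuous (𝓕 (fun y => (f y : ℂ))) :=
      continuous_fourierIntegral hf.ofReal
    have hFfb : ∀ k, ‖𝓕 (fun y => (f y : ℂ)) k‖ ≤ ∫ y, ‖(f y : ℂ)‖ := fun k =>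
      VectorFourier.norm_fourierIntegral_le_integral_norm 𝐞 volume (innerₗ ℝ) (fun y => (f y : ℂ)) k
    have hms : Measurable fun k : ℝ => ((Real.sign k : ℝ) : ℂ) := Complex.measurable_ofReal.comp measurable_real_sign
    have hsgn1 : ∀ k, ‖(((-Real.sign k : ℝ) : ℂ) * I)‖ ≤ 1 := by
      intro k
      rw [norm_mul, Complex.norm_I, mul_one, Complex.norm_real, Real.norm_eq_abs, abs_neg]
      rcases lt_trichotomy k 0 with hk | rfl | hk
      · rw [Real.sign_of_neg hk]; simp
      · rw [Real.sign_zero]; simp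
      · rw [Real.sign_of_pos hk]; simp
    have hi1 : Integrable fun k => 𝓕 (fun y => (f y : ℂ)) k * θ k :=
      hθi.bdd_mul hFc.aestronglyMeasurable (ae_of_all _ hFfb)
    have hi2 : Integrable fun k => ((((-Real.sign k) : ℝ) : ℂ) * I) * 𝓕 (fun y => (f y : ℂ)) k * θ k := by
      have h := hi1.bdd_mul ((hms.neg.mul_const I).aestronglyMeasurable.congr ?_) (ae_of_all _ hsgn1)
      · refine h.congr (ae_of_all _ fun k => ?_); simp only; ring
      · exact ae_of_all _ fun k => by simp
    have hi3 : Integrable fun k => G k * θ k := by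
      have h2 : ∀ k, ‖(1 : ℂ) + ((Real.sign k : ℝ) : ℂ)‖ ≤ 2 := by
        intro k
        rcases lt_trichotomy k 0 with hk | rfl | hk
        · rw [Real.sign_of_neg hk]; simp
        · rw [Real.sign_zero]; simp
        · rw [Real.sign_of_pos hk]; norm_num
      have h := hi1.bdd_mul ((hms.const_add 1).aestronglyMeasurable) (ae_of_all _ h2)
      refine h.congr (ae_of_all _ fun k => ?_); simp only [hG]; ring
    -- compute `∫ D · 𝓕θ`
    have hsumx : Integrable fun x => (f x : ℂ) * 𝓕 (θ : ℝ → ℂ) x + I * ((hilbertTransform f x : ℂ) * 𝓕 (θ : ℝ → ℂ) x) :=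
      hi_f.add (hi_H.const_mul I)
    have hsplit : ∫ x, D x * 𝓕 (θ : ℝ → ℂ) x
        = (∫ x, (f x : ℂ) * 𝓕 (θ : ℝ → ℂ) x) + I * (∫ x, (hilbertTransform f x : ℂ) * 𝓕 (θ : ℝ → ℂ) x)
          - ∫ x, 𝓕⁻ G x * 𝓕 (θ : ℝ → ℂ) x := by
      have e1 : ∫ x, D x * 𝓕 (θ : ℝ → ℂ) x = ∫ x, (((f x : ℂ) * 𝓕 (θ : ℝ → ℂ) x
          + I * ((hilbertTransform f x : ℂ) * 𝓕 (θ : ℝ → ℂ) x)) - 𝓕⁻ G x * 𝓕 (θ : ℝ → ℂ) x) :=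
        integral_congr_ae (ae_of_all _ fun x => by simp only [hD]; ring)
      rw [e1, integral_sub hsumx hi_G, integral_add hi_f (hi_H.const_mul I), integral_const_mul]
    have hsumk : Integrable fun k => 𝓕 (fun y => (f y : ℂ)) k * θ k
        + I * (((((-Real.sign k) : ℝ) : ℂ) * I) * 𝓕 (fun y => (f y : ℂ)) k * θ k) := hi1.add (hi2.const_mul I)
    have hzero : ∀ k, 𝓕 (fun y => (f y : ℂ)) k * θ k + I * (((((-Real.sign k) : ℝ) : ℂ) * I) * 𝓕 (fun y => (f y : ℂ)) k * θ k)
        - G k * θ k = 0 := by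
      intro k
      simp only [hG]
      have hI : I * I = -1 := Complex.I_mul_I
      push_cast
      linear_combination (-(((Real.sign k : ℝ) : ℂ)) * 𝓕 (fun y => (f y : ℂ)) k * θ k) * hI
    have hcomb : (∫ k, 𝓕 (fun y => (f y : ℂ)) k * θ k)
        + I * (∫ k, ((((-Real.sign k) : ℝ) : ℂ) * I) * 𝓕 (fun y => (f y : ℂ)) k * θ k) - (∫ k, G k * θ k)
        = ∫ k, (𝓕 (fun y => (f y : ℂ)) k * θ k + I * (((((-Real.sign k) : ℝ) : ℂ) * I) * 𝓕 (fun y => (f y : ℂ)) k * θ k)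
          - G k * θ k) := by
      rw [integral_sub hsumk hi3, integral_add hi1 (hi2.const_mul I), integral_const_mul]
    rw [hsplit, e_f, e_H, e_G, hcomb]
    simp_rw [hzero, integral_zero]
  have := congrFun hD0 x
  simpa [hD, sub_eq_zero] using this

end Literature.Analysis.Fourier
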